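import Summits.ValiantsHypothesis.ValiantsHypothesis.Theorems.FifoMatchingNNDivisionHardLocalizationCube

/-!
# FifoMatching · NNDivisionHard — localization, part 10: §B5 STICK-OUT CUBES, Ω-INJECTIVE TOP LAYERS and the INNER READ — members of `Face Quiet` (S43-4)

Theorems-grade port (bytes staged by val-idea-43 g6 for a port hand) of §B5 of the crux workfile `Cruxes/NNDivisionHard/Symmetry43.lean`
REV 3 @6f612840a212 (sha16 feaccae65024a9a0, 1343 l.; critic of record val-idea-crit-9 g3 V#106 GO; classification of record: INSTANCE FAMILY
of S43-2 `Face Quiet` (lever (B), genus I), NOT a new class — it earns kernel time because it EMPTIES a live cell: R334 / V#103 lane (b)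
«zonotope lists with all generator supports in `[n/K(c,n), n/2]`») — statements and proofs VERBATIM, namespace `…Theorems.FifoMatching.Localization`
(imports part 9 `…LocalizationCube`).

Part 10 = the MEMBERSHIP CERTIFICATES, all through `faceQuiet_of_twoScaleTop` / `face_of_twoScale` with first scale `pinOff ι` and a generic
second scale outside `ι × ι` (`⌊√h⌋ ≤ ℓ`):
* (s2, general lists) ★ `faceQuiet_of_topLayer_injOn`: the `pinOff ι`-top layer is Ω-INJECTIVE (two top-layer points agreeing outside `ι × ι`
  are equal) ⇒ `Face Quiet`; class `OmegaInjTop`, ★★ `omegaInjTop_decided`;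
* ★ `faceQuiet_of_zono_stickOut` / `faceQuiet_of_cube_stickOut`: a vertex-complete zonotope list (resp. full cube list) every generator of which
  has a nonzero entry OUTSIDE `ι × ι` ⇒ the lex-optimal PATTERN is unique termwise ⇒ `Face Quiet` (a sibling of (s2), not a corollary: two
  pin-blind Ω-equal generators give Ω-equal distinct top-layer points, which the termwise argument still excludes from the lex top); classes
  `StickOutCube` / `FatCube`, ★★ `stickOutCube_decided`, ★★ `fatCube_decided` (every generator has MORE THAN `⌊√h⌋` active columns OR rows,
  `ℓ = ⌊√h⌋`, any `ι` — contains every zonotope list whose generator supports all exceed `√h`, in particular the whole window `[n/K(c,n), n/2]`);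
* ★ `face_of_cube_inner` (mixed cubes, enemy clause (E-5)): generators `gi ⊕ go` with the `gi` supported inside `ι × ι` and every `go` sticking
  out ⇒ the two-scale top class read on `ι` is a FULL CUBE LIST on `delRead ι ∘ gi`, so `q ∈ Face X` whenever `X` holds at scale `ℓ` for those.

Honest label: species / instance theorems (COR-VIRTUAL on a class) for the TOP cone; NOT progress on `C′ = ExactPencilLaw` nor on `CoreLawOrb`;
0 explicit residual members before and after; 21181 OPEN; VP ≠ VNP NOT proved.
-/

set_option linter.unusedVariables false
set_option linter.unusedSectionVars false
set_option linter.dupNamespace false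

namespace Summit.ValiantsHypothesis.ValiantsHypothesis.Theorems.FifoMatching.Localization

open Matrix Finset
open scoped Pointwise
open Literature.Barriers.PneNP (HasEFOfSize)
open Literature.Combinatorics.Optimization (corPolytopeGraph corVec)

/-! ### (s2) Ω-injective top layers -/

/-- ★ **Ω-INJECTIVE TOP LAYERS ∈ `Face Quiet`** (the general list form, V#106 (s2)): if two points of the `pinOff ι`-top
layer of `q` that agree OUTSIDE `ι × ι` are equal (`⌊√h⌋ ≤ ℓ`), a generic tilt outside `ι × ι` makes the two-scale top
unique, and `q ∈ Face Quiet`. -/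
theorem faceQuiet_of_topLayer_injOn {h ℓ K : ℕ} (q : Fam h K) (hℓ : Nat.sqrt h ≤ ℓ) (ι : Fin ℓ ↪ Fin h)
    (hinj : ∀ j j', (∀ k, pinOff ι ⬝ᵥ q k ≤ pinOff ι ⬝ᵥ q j) → (∀ k, pinOff ι ⬝ᵥ q k ≤ pinOff ι ⬝ᵥ q j') →
      (∀ p, Outside ι p → q j p = q j' p) → q j = q j') :
    Face Quiet h K q := by
  classical
  -- a generic tilt separating the Ω-distinct pairs
  let G : Fin (K + 1) × Fin (K + 1) → (Fin h × Fin h → ℝ) := fun jj => q jj.1 - q jj.2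
  obtain ⟨v, hv0, hvG⟩ := exists_generic_outside ι
    (Finset.univ.filter fun jj : Fin (K + 1) × Fin (K + 1) => ∃ p, Outside ι p ∧ G jj p ≠ 0) G
    (fun jj hjj => (Finset.mem_filter.mp hjj).2)
  have hv : ∀ b : Fin h → Bool, pinOff ι ⬝ᵥ corVec (⊤ : SimpleGraph (Fin h)) b = 0 →
      v ⬝ᵥ corVec (⊤ : SimpleGraph (Fin h)) b = 0 := pinOff_outside ι v hv0
  -- a lex-maximal index
  obtain ⟨j₁, -, hj₁⟩ := Finset.exists_max_image Finset.univ (fun j => pinOff ι ⬝ᵥ q j) Finset.univ_nonempty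
  let Tl : Finset (Fin (K + 1)) := Finset.univ.filter fun j => ∀ k, pinOff ι ⬝ᵥ q k ≤ pinOff ι ⬝ᵥ q j
  have hTl : Tl.Nonempty := ⟨j₁, Finset.mem_filter.mpr ⟨Finset.mem_univ _, fun k => hj₁ k (Finset.mem_univ k)⟩⟩
  obtain ⟨j₀, hj₀T, hj₀⟩ := Finset.exists_max_image Tl (fun j => v ⬝ᵥ q j) hTl
  have hj₀top : ∀ k, pinOff ι ⬝ᵥ q k ≤ pinOff ι ⬝ᵥ q j₀ := (Finset.mem_filter.mp hj₀T).2
  refine faceQuiet_of_twoScaleTop q hℓ ι (pinOff ι) v 0 0 (pinOff_corVec_le ι) (pinOff_free ι) hv j₀ fun j => ?_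
  rcases (hj₀top j).lt_or_eq with hlt | heqW
  · exact Or.inl (Or.inl hlt)
  have hjtop : ∀ k, pinOff ι ⬝ᵥ q k ≤ pinOff ι ⬝ᵥ q j := fun k => (hj₀top k).trans_eq heqW.symm
  have hjT : j ∈ Tl := Finset.mem_filter.mpr ⟨Finset.mem_univ _, hjtop⟩
  rcases (hj₀ j hjT).lt_or_eq with hlt | heqV
  · exact Or.inl (Or.inr ⟨heqW, hlt⟩)
  refine Or.inr (hinj j j₀ hjtop hj₀top fun p hp => ?_)
  by_contra hne
  have hmem : (j, j₀) ∈ Finset.univ.filter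
      (fun jj : Fin (K + 1) × Fin (K + 1) => ∃ p, Outside ι p ∧ G jj p ≠ 0) :=
    Finset.mem_filter.mpr ⟨Finset.mem_univ _, p, hp, fun h0 => hne (sub_eq_zero.mp h0)⟩
  have h1 := hvG (j, j₀) hmem
  rw [dotProduct_sub, heqV, sub_self] at h1
  exact h1 rfl

/-- the Ω-INJECTIVE-TOP class ((s2) as a class): some admissible `ι` whose pin-top layer is Ω-injective. -/
def OmegaInjTop : PClass := fun h K q =>
  ∃ ℓ : ℕ, Nat.sqrt h ≤ ℓ ∧ ∃ ι : Fin ℓ ↪ Fin h, ∀ j j', (∀ k, pinOff ι ⬝ᵥ q k ≤ pinOff ι ⬝ᵥ q j) →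
    (∀ k, pinOff ι ⬝ᵥ q k ≤ pinOff ι ⬝ᵥ q j') → (∀ p, Outside ι p → q j p = q j' p) → q j = q j'

/-- ★★ **Ω-INJECTIVE TOPS ARE DECIDED.** -/
theorem omegaInjTop_decided : Decided OmegaInjTop :=
  decided_anti (fun _ _ q ⟨_, hℓ, ι, hinj⟩ => faceQuiet_of_topLayer_injOn q hℓ ι hinj) faceQuiet_decided

/-! ### stick-out cubes and zonotope lists -/

/-- ★ **STICK-OUT ZONOTOPE LISTS ∈ `Face Quiet`**: a vertex-complete zonotope list every generator of which has a nonzero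
entry outside `ι × ι` (`⌊√h⌋ ≤ ℓ`) has a UNIQUE two-scale top on the free `ι`-face — pins off `ι` first, a generic tilt
outside `ι × ι` second; the lex-optimal PATTERN is unique termwise. -/
theorem faceQuiet_of_zono_stickOut {h ℓ K : ℕ} {τ : Type*} [Fintype τ] [DecidableEq τ] (q : Fam h K)
    (hℓ : Nat.sqrt h ≤ ℓ) (ι : Fin ℓ ↪ Fin h) (q₀ : Fin h × Fin h → ℝ) (g : τ → (Fin h × Fin h → ℝ))
    (hq : IsZonoList q q₀ g) (hout : ∀ t, ∃ p, Outside ι p ∧ g t p ≠ 0) : Face Quiet h K q := by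
  classical
  obtain ⟨v, hv0, hvne⟩ := exists_generic_outside ι (Finset.univ : Finset τ) g fun t _ => hout t
  have hv : ∀ b : Fin h → Bool, pinOff ι ⬝ᵥ corVec (⊤ : SimpleGraph (Fin h)) b = 0 →
      v ⬝ᵥ corVec (⊤ : SimpleGraph (Fin h)) b = 0 := pinOff_outside ι v hv0
  obtain ⟨εs, hεs⟩ := exists_lexPattern (fun t => pinOff ι ⬝ᵥ g t) (fun t => v ⬝ᵥ g t)
    fun t => Or.inr (hvne t (Finset.mem_univ t))
  obtain ⟨j₀, hj₀⟩ := hq.2 εs ⟨pinOff ι, v, hεs⟩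
  refine faceQuiet_of_twoScaleTop q hℓ ι (pinOff ι) v 0 0 (pinOff_corVec_le ι) (pinOff_free ι) hv j₀ fun j => ?_
  obtain ⟨ε, hε⟩ := hq.1 j
  have hdiffW : pinOff ι ⬝ᵥ q j - pinOff ι ⬝ᵥ q j₀ = ∑ t, (bit (ε t) - bit (εs t)) * (pinOff ι ⬝ᵥ g t) := by
    rw [hε, hj₀]; exact dotProduct_cubePoint_sub _ _ _ _ _
  have hdiffV : v ⬝ᵥ q j - v ⬝ᵥ q j₀ = ∑ t, (bit (ε t) - bit (εs t)) * (v ⬝ᵥ g t) := by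
    rw [hε, hj₀]; exact dotProduct_cubePoint_sub _ _ _ _ _
  have hWle : pinOff ι ⬝ᵥ q j ≤ pinOff ι ⬝ᵥ q j₀ := by
    have h1 := lexPattern_sum_fst hεs ε
    rw [← hdiffW] at h1; linarith
  rcases hWle.lt_or_eq with hlt | heqW
  · exact Or.inl (Or.inl hlt)
  have hW0 : ∑ t, (bit (ε t) - bit (εs t)) * (pinOff ι ⬝ᵥ g t) = 0 := by rw [← hdiffW, heqW, sub_self]
  have hVle : v ⬝ᵥ q j ≤ v ⬝ᵥ q j₀ := by
    have h1 := lexPattern_sum_snd hεs ε hW0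
    rw [← hdiffV] at h1; linarith
  rcases hVle.lt_or_eq with hlt | heqV
  · exact Or.inl (Or.inr ⟨heqW, hlt⟩)
  have hV0 : ∑ t, (bit (ε t) - bit (εs t)) * (v ⬝ᵥ g t) = 0 := by rw [← hdiffV, heqV, sub_self]
  refine Or.inr ?_
  rw [hε, hj₀, lexPattern_sum_eq hεs ε hW0 hV0]

/-- ★ **STICK-OUT CUBES ∈ `Face Quiet`** (full cube lists). -/
theorem faceQuiet_of_cube_stickOut {h ℓ K : ℕ} {τ : Type*} [Fintype τ] [DecidableEq τ] (q : Fam h K)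
    (hℓ : Nat.sqrt h ≤ ℓ) (ι : Fin ℓ ↪ Fin h) (q₀ : Fin h × Fin h → ℝ) (g : τ → (Fin h × Fin h → ℝ))
    (hq : IsCubeList q q₀ g) (hout : ∀ t, ∃ p, Outside ι p ∧ g t p ≠ 0) : Face Quiet h K q :=
  faceQuiet_of_zono_stickOut q hℓ ι q₀ g hq.isZonoList hout

/-- the STICK-OUT CUBE class: vertex-complete zonotope lists whose generators all stick out of some admissible `ι × ι`. -/
def StickOutCube : PClass := fun h K q =>
  ∃ ℓ : ℕ, Nat.sqrt h ≤ ℓ ∧ ∃ (ι : Fin ℓ ↪ Fin h) (q₀ : Fin h × Fin h → ℝ) (m : ℕ) (g : Fin m → (Fin h × Fin h → ℝ)),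
    IsZonoList q q₀ g ∧ ∀ t, ∃ p, Outside ι p ∧ g t p ≠ 0

/-- ★★ **STICK-OUT CUBES ARE DECIDED** (COR-VIRTUAL holds on the class, genus-I rate `c ↦ 2c`). -/
theorem stickOutCube_decided : Decided StickOutCube :=
  decided_anti (fun _ _ q ⟨_, hℓ, ι, q₀, _, g, hq, hout⟩ => faceQuiet_of_zono_stickOut q hℓ ι q₀ g hq hout)
    faceQuiet_decided

/-- the ACTIVE COLUMNS of a generator. -/
noncomputable def activeCols {h : ℕ} (y : Fin h × Fin h → ℝ) : Finset (Fin h) :=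
  Finset.univ.filter fun k => ∃ x, y (x, k) ≠ 0

/-- the ACTIVE ROWS of a generator. -/
noncomputable def activeRows {h : ℕ} (y : Fin h × Fin h → ℝ) : Finset (Fin h) :=
  Finset.univ.filter fun x => ∃ k, y (x, k) ≠ 0

/-- a generator with more than `ℓ` active columns or rows sticks out of every `ι × ι`, `|ι| = ℓ`. -/
theorem stickOut_of_fat {h ℓ : ℕ} (ι : Fin ℓ ↪ Fin h) (y : Fin h × Fin h → ℝ)
    (hfat : ℓ < (activeCols y).card ∨ ℓ < (activeRows y).card) : ∃ p, Outside ι p ∧ y p ≠ 0 := by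
  classical
  by_contra hcon
  have hcols : activeCols y ⊆ Finset.univ.map ι := fun k hk => by
    obtain ⟨x, hx⟩ := (Finset.mem_filter.mp hk).2
    by_contra hk'
    exact hcon ⟨(x, k), Or.inr fun a ha => hk' (Finset.mem_map.mpr ⟨a, Finset.mem_univ a, ha⟩), hx⟩
  have hrows : activeRows y ⊆ Finset.univ.map ι := fun x hx => by
    obtain ⟨k, hk⟩ := (Finset.mem_filter.mp hx).2
    by_contra hx'
    exact hcon ⟨(x, k), Or.inl fun a ha => hx' (Finset.mem_map.mpr ⟨a, Finset.mem_univ a, ha⟩), hk⟩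
  have h1 := Finset.card_le_card hcols
  have h2 := Finset.card_le_card hrows
  rw [Finset.card_map, Finset.card_univ, Fintype.card_fin] at h1 h2
  rcases hfat with h3 | h3
  · exact absurd h3 (not_lt.2 h1)
  · exact absurd h3 (not_lt.2 h2)

/-- ★★ **ALL-FAT CUBES**: a vertex-complete zonotope list every generator of which has MORE THAN `⌊√h⌋` active columns OR
rows is in `Face Quiet` (`ℓ = ⌊√h⌋`, any `ι`).  This contains every zonotope list whose generator column supports all lie
in `(√h, h]` — in particular the whole window `[n/K(c,n), n/2]` of the W7 enemy spec, in every rooting / switching. -/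
theorem faceQuiet_of_cube_fat {h K : ℕ} {τ : Type*} [Fintype τ] [DecidableEq τ] (q : Fam h K)
    (q₀ : Fin h × Fin h → ℝ) (g : τ → (Fin h × Fin h → ℝ)) (hq : IsZonoList q q₀ g)
    (hfat : ∀ t, Nat.sqrt h < (activeCols (g t)).card ∨ Nat.sqrt h < (activeRows (g t)).card) : Face Quiet h K q :=
  faceQuiet_of_zono_stickOut q le_rfl (Fin.castLEEmb (Nat.sqrt_le_self h)) q₀ g hq
    fun t => stickOut_of_fat _ (g t) (hfat t)

/-- the FAT CUBE class. -/
def FatCube : PClass := fun h K q =>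
  ∃ (q₀ : Fin h × Fin h → ℝ) (m : ℕ) (g : Fin m → (Fin h × Fin h → ℝ)),
    IsZonoList q q₀ g ∧ ∀ t, Nat.sqrt h < (activeCols (g t)).card ∨ Nat.sqrt h < (activeRows (g t)).card

/-- ★★ **FAT CUBES ARE DECIDED.** -/
theorem fatCube_decided : Decided FatCube :=
  decided_anti (fun _ _ q ⟨q₀, _, g, hq, hfat⟩ => faceQuiet_of_cube_fat q q₀ g hq hfat) faceQuiet_decided

/-! ### mixed cubes: the top class read on `ι` is the inner sub-cube -/

/-- ★ **MIXED CUBES READ TO THE INNER SUB-CUBE** (enemy clause (E-5)): for a full cube list on generators `gi ⊕ go` with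
the `gi` supported INSIDE `ι × ι` and every `go` sticking OUT of it (`⌊√h⌋ ≤ ℓ`), the two-scale top class is the full
sub-cube over the lex-optimal outer pattern, and its read on `ι` is a FULL CUBE LIST on the read inner generators; so
`q ∈ Face X` whenever `X` (at scale `ℓ`) contains every full cube list on the generators `delRead ι ∘ gi`. -/
theorem face_of_cube_inner {X : PClass} {h ℓ K : ℕ} {τi τo : Type*} [Fintype τi] [Fintype τo] [DecidableEq τi]
    [DecidableEq τo] (q : Fam h K) (hℓ : Nat.sqrt h ≤ ℓ) (ι : Fin ℓ ↪ Fin h) (q₀ : Fin h × Fin h → ℝ)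
    (gi : τi → (Fin h × Fin h → ℝ)) (go : τo → (Fin h × Fin h → ℝ)) (hq : IsCubeList q q₀ (Sum.elim gi go))
    (hin : ∀ t p, Outside ι p → gi t p = 0) (hout : ∀ t, ∃ p, Outside ι p ∧ go t p ≠ 0)
    (hx : ∀ (K' : ℕ) (q' : Fam ℓ K') (q₀' : Fin ℓ × Fin ℓ → ℝ),
      IsCubeList q' q₀' (fun t => delRead ι (gi t)) → X ℓ K' q') :
    Face X h K q := by
  classical
  -- the two scales; both are blind to the inner generators
  obtain ⟨v, hv0, hvne⟩ := exists_generic_outside ι (Finset.univ : Finset τo) go fun t _ => hout t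
  have hv : ∀ b : Fin h → Bool, pinOff ι ⬝ᵥ corVec (⊤ : SimpleGraph (Fin h)) b = 0 →
      v ⬝ᵥ corVec (⊤ : SimpleGraph (Fin h)) b = 0 := pinOff_outside ι v hv0
  have hvi : ∀ t, v ⬝ᵥ gi t = 0 := fun t => by
    unfold dotProduct
    refine Finset.sum_eq_zero fun p _ => ?_
    by_cases hp : Outside ι p
    · rw [hin t p hp, mul_zero]
    · rw [hv0 p hp, zero_mul]
  have hwi : ∀ t, pinOff ι ⬝ᵥ gi t = 0 := fun t => pinOff_dotProduct_eq_zero ι (gi t) (hin t)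
  -- the lex-optimal OUTER pattern and the indices of the top sub-cube
  obtain ⟨εo, hεo⟩ := exists_lexPattern (fun t => pinOff ι ⬝ᵥ go t) (fun t => v ⬝ᵥ go t)
    fun t => Or.inr (hvne t (Finset.mem_univ t))
  have hidx' : ∀ δ : τi → Bool, ∃ j, q j = cubePoint q₀ (Sum.elim gi go) (Sum.elim δ εo) := fun δ => hq.2 _
  choose idx hidx using hidx'
  obtain ⟨K', hK'⟩ : ∃ K', K' + 1 = Fintype.card (τi → Bool) := ⟨_, Nat.sub_add_cancel Fintype.card_pos⟩
  let enum : Fin (K' + 1) ≃ (τi → Bool) := (finCongr hK').trans (Fintype.equivFin (τi → Bool)).symm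
  obtain ⟨e, he⟩ : ∃ e : Fin (K' + 1) → Fin (K + 1), ∀ j', e j' = idx (enum j') := ⟨_, fun _ => rfl⟩
  -- a functional blind to `gi` compares a listed point with a top-sub-cube point through the OUTER bits only
  have hdiff : ∀ u : Fin h × Fin h → ℝ, (∀ t, u ⬝ᵥ gi t = 0) → ∀ (εk : τi ⊕ τo → Bool) (δ : τi → Bool),
      u ⬝ᵥ cubePoint q₀ (Sum.elim gi go) εk - u ⬝ᵥ cubePoint q₀ (Sum.elim gi go) (Sum.elim δ εo) =
        ∑ t, (bit (εk (Sum.inr t)) - bit (εo t)) * (u ⬝ᵥ go t) := by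
    intro u hu εk δ
    rw [dotProduct_cubePoint_sub, Fintype.sum_sum_type]
    simp only [Sum.elim_inl, Sum.elim_inr, hu, mul_zero, Finset.sum_const_zero, zero_add]
  -- every listed point is lex-dominated by every top-sub-cube point
  have hcmp : ∀ k (δ : τi → Bool), pinOff ι ⬝ᵥ q k < pinOff ι ⬝ᵥ q (idx δ) ∨
      (pinOff ι ⬝ᵥ q k = pinOff ι ⬝ᵥ q (idx δ) ∧ v ⬝ᵥ q k ≤ v ⬝ᵥ q (idx δ)) := by
    intro k δ
    obtain ⟨εk, hεk⟩ := hq.1 k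
    have hW := hdiff (pinOff ι) hwi εk δ
    rw [← hεk, ← hidx δ] at hW
    have hWle : pinOff ι ⬝ᵥ q k ≤ pinOff ι ⬝ᵥ q (idx δ) := by
      have h1 := lexPattern_sum_fst hεo (fun t => εk (Sum.inr t))
      rw [← hW] at h1; linarith
    rcases hWle.lt_or_eq with hlt | heq
    · exact Or.inl hlt
    · refine Or.inr ⟨heq, ?_⟩
      have hV := hdiff v hvi εk δ
      rw [← hεk, ← hidx δ] at hV
      have h1 := lexPattern_sum_snd hεo (fun t => εk (Sum.inr t)) (by rw [← hW, heq, sub_self])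
      rw [← hV] at h1; linarith
  -- a lex-dominating listed point IS a top-sub-cube point
  have htopeq : ∀ j, (∀ k, pinOff ι ⬝ᵥ q k < pinOff ι ⬝ᵥ q j ∨
      (pinOff ι ⬝ᵥ q k = pinOff ι ⬝ᵥ q j ∧ v ⬝ᵥ q k ≤ v ⬝ᵥ q j)) → ∃ δ, q (idx δ) = q j := by
    intro j hj
    obtain ⟨εj, hεj⟩ := hq.1 j
    refine ⟨fun t => εj (Sum.inl t), ?_⟩
    have hW := hdiff (pinOff ι) hwi εj (fun t => εj (Sum.inl t))
    rw [← hεj, ← hidx] at hW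
    have hV := hdiff v hvi εj (fun t => εj (Sum.inl t))
    rw [← hεj, ← hidx] at hV
    have hWeq : pinOff ι ⬝ᵥ q j = pinOff ι ⬝ᵥ q (idx fun t => εj (Sum.inl t)) := by
      rcases hj (idx fun t => εj (Sum.inl t)) with h1 | ⟨h1, -⟩
      · rcases hcmp j (fun t => εj (Sum.inl t)) with h2 | ⟨h2, -⟩
        · exact absurd h1 (not_lt.2 h2.le)
        · exact h2
      · exact h1.symm
    have hVeq : v ⬝ᵥ q j = v ⬝ᵥ q (idx fun t => εj (Sum.inl t)) := by
      rcases hj (idx fun t => εj (Sum.inl t)) with h1 | ⟨-, h1⟩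
      · exact absurd hWeq h1.ne'
      · rcases hcmp j (fun t => εj (Sum.inl t)) with h2 | ⟨-, h2⟩
        · exact absurd hWeq h2.ne
        · exact le_antisymm h2 h1
    have hW0 : ∑ t, (bit (εj (Sum.inr t)) - bit (εo t)) * (pinOff ι ⬝ᵥ go t) = 0 := by
      rw [← hW, hWeq, sub_self]
    have hV0 : ∑ t, (bit (εj (Sum.inr t)) - bit (εo t)) * (v ⬝ᵥ go t) = 0 := by
      rw [← hV, hVeq, sub_self]
    have hout_eq := lexPattern_sum_eq hεo (fun t => εj (Sum.inr t)) hW0 hV0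
    rw [hidx, hεj]
    congr 1
    funext t
    rcases t with t | t
    · rfl
    · exact (congr_fun hout_eq t).symm
  -- the read of the top sub-cube is a FULL inner cube list at scale `ℓ`
  have hread : IsCubeList (⇑(delRead ι) ∘ q ∘ e) (delRead ι (cubePoint q₀ go εo)) (fun t => delRead ι (gi t)) := by
    refine ⟨fun j' => ⟨enum j', ?_⟩, fun δ => ⟨enum.symm δ, ?_⟩⟩
    · rw [Function.comp_apply, Function.comp_apply, he, hidx, cubePoint_sum_elim, delRead_cubePoint]
    · rw [Function.comp_apply, Function.comp_apply, he, Equiv.apply_symm_apply, hidx, cubePoint_sum_elim,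
        delRead_cubePoint]
  refine face_of_twoScale q hℓ ι (pinOff ι) v 0 0 (pinOff_corVec_le ι) (pinOff_free ι) hv e
    (fun j' k => by rw [he]; exact hcmp k (enum j')) (fun j hj => ?_) (hx K' _ _ hread)
  obtain ⟨δ, hδ⟩ := htopeq j hj
  exact ⟨enum.symm δ, by rw [he, Equiv.apply_symm_apply]; exact hδ⟩

end Summit.ValiantsHypothesis.ValiantsHypothesis.Theorems.FifoMatching.Localization
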